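import Mathlib
import Summits.ValiantsHypothesis.ValiantsHypothesis.Theses.FreeSubtorus
import Literature.Computability.AlgebraicComplexity.LRPencilOfMatrix
import Literature.Computability.AlgebraicComplexity.GrenetEquivariant
import Literature.Computability.AlgebraicComplexity.DetReprEquivalent
import Literature.Computability.AlgebraicComplexity.GenericTorusGrading
import Literature.Computability.AlgebraicComplexity.LandsbergRessayreProofs
import Summits.ValiantsHypothesis.ValiantsHypothesis.Theorems.FreeSubtorusOrbitDimensionBoundStubTightModLatticeLifts
import Summits.ValiantsHypothesis.ValiantsHypothesis.Theorems.FreeSubtorusOrbitDimensionBoundStubInitialFormAccumulates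
import Summits.ValiantsHypothesis.ValiantsHypothesis.Theorems.FreeSubtorusOrbitDimensionBoundSlices
import Summits.ValiantsHypothesis.ValiantsHypothesis.Theorems.FreeSubtorusOrbitDimensionBoundStubPerpBasis
import Summits.ValiantsHypothesis.ValiantsHypothesis.Theorems.FreeSubtorusOrbitDimensionBoundStubEigenGauge
import Summits.ValiantsHypothesis.ValiantsHypothesis.Theorems.FreeSubtorusOrbitDimensionBoundStubDegMap
import Summits.ValiantsHypothesis.ValiantsHypothesis.Theorems.FreeSubtorusOrbitDimensionBoundStubSaturationBasis
import Summits.ValiantsHypothesis.ValiantsHypothesis.Theorems.FreeSubtorusOrbitDimensionBoundConverse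
import Literature.LinearAlgebra.Matrix.PermanentLaplace
import Literature.Computability.AlgebraicComplexity.StandardFamiliesProofs
import Literature.Computability.AlgebraicComplexity.PermanentVsDeterminantProofs
import Literature.Computability.AlgebraicComplexity.DeterminantalComplexityProofs
import Literature.LinearAlgebra.Matrix.PermanentEqualRows
import Summits.ValiantsHypothesis.ValiantsHypothesis.Theorems.FreeSubtorusOrbitDimensionBoundStubMultilinearVanish
import Summits.ValiantsHypothesis.ValiantsHypothesis.Theorems.FreeSubtorusOrbitDimensionBoundStubFiltrationFinrank
import Summits.ValiantsHypothesis.ValiantsHypothesis.Theorems.FreeSubtorusOrbitDimensionBoundStubPerProductBound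
import Summits.ValiantsHypothesis.ValiantsHypothesis.Theorems.FreeSubtorusOrbitDimensionBoundStubSliceRankOfBound
import Summits.ValiantsHypothesis.ValiantsHypothesis.Theorems.FreeSubtorusOrbitDimensionBoundSliceRank
import Summits.ValiantsHypothesis.ValiantsHypothesis.Theorems.FreeSubtorusOrbitDimensionBoundStubHomothetyGraded
import Summits.ValiantsHypothesis.ValiantsHypothesis.Theorems.FreeSubtorusOrbitDimensionBoundStubGradedElimination
import Summits.ValiantsHypothesis.ValiantsHypothesis.Theorems.FreeSubtorusOrbitDimensionBoundStubPartialPermDiag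
import Summits.ValiantsHypothesis.ValiantsHypothesis.Theorems.FreeSubtorusOrbitDimensionBoundStubLayerDecomposition

/-!
# `FreeSubtorus.OrbitDimensionBound` (crux stmt-ValiantsHypothesis-16133) — line `Sketch`
# (matching-face accumulation): lattice-tight supports lift diagonally; initial forms accumulate

Crux (rank 2 of route-ValiantsHypothesis-FreeSubtorus), BY NAME:
`Summit.ValiantsHypothesis.ValiantsHypothesis.Theses.FreeSubtorus.OrbitDimensionBound` — for `n ≥ 3`
and every `m`: if `per_n` has an affine determinantal representation of size `m`, then it has one of
the SAME size `m` that is equivariant with exact `GL_m × GL_m` lifts under the subtorus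
`T_Λ = closure {diag(d_k e_l) : Π_k d_k^{Λ_t(inl k)} Π_l e_l^{Λ_t(inr l)} = 1 ∀ t}` of the two-sided
torus `T' = (ℂˣ)ⁿ × (ℂˣ)ⁿ`, for some `r ≤ n/2` ADMISSIBLE relations `Λ_t` (zero row-sum and zero
column-sum).

## The line (idea card `Ideas/matching-face-accumulation.md`, planner k1's `Sketch.lean`)

Write `M = ℤ^(Fin n ⊕ Fin n)` for the character lattice of `T'`; the variable `x_{kl}` has weight
`e_{kl} = e_{inl k} + e_{inr l} ∈ M`, a constant has weight `0`, and every monomial of `per_n` has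
weight `𝟙 = Σ_q e_q`.  For an `m × m` matrix `B` of AFFINE polynomials write `B₀ = constPart B`
(constants) and `B_p = coeffMat B p` (coefficients of `x_p`).

* **Stub 1 (`stub_tightModLatticeLifts`, provable now):** if `B` is an affine determinantal
  representation of `per_n` whose support is TIGHT MODULO the lattice `ℤΛ` for potentials
  `α, β : Fin m → M` — a constant sits at `(i,j)` only if `α i + β j ∈ ℤΛ`, the variable `x_p` only
  if `α i + β j - e_p ∈ ℤΛ` — then `B` is `T_Λ`-equivariant: for a generator `t = (d,e)` of `T_Λ`
  (all `χ_{Λ_t}(d,e) = 1`) every monomial at `(i,j)` is rescaled by `χ_{α i}(d,e) χ_{β j}(d,e)`, so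
  `B(t·x) = diag(χ_{α i}) · B · diag(χ_{β j})` (DIAGONAL exact lift), and exact lifts of generators give
  equivariance for the closure (`IsEquivariantDetRepr.of_generators`).  The case `Λ = 0` is the landed
  `RigidMinimalRepsMinimalRepTorusSymmetricStubTightLifts.stub_tightLifts`.
* **Stub 2 (`stub_initialFormAccumulates`, provable now):** for ONE cocharacter `μ : Fin n ⊕ Fin n → ℤ`
  and integer potentials `a, b : Fin m → ℤ` forming a SUB-POTENTIAL of a representation `B` of `per_n`
  (`B₀ i j ≠ 0 ⇒ a i + b j ≤ 0`, `(B_p) i j ≠ 0 ⇒ a i + b j ≤ ⟨μ, e_p⟩ = μ(inl p.1) + μ(inr p.2)`,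
  `Σ a + Σ b = ⟨μ, 𝟙⟩ = Σ_q μ q`), the INITIAL FORM of `B` along `(μ, a, b)` (keep at `(i,j)` exactly the
  monomials of `μ`-weight `a i + b j`) is again an affine determinantal representation of `per_n` of the
  same size, with supports inside those of `B`, and `μ`-TIGHT.  (Białynicki-Birula limit along `μ`;
  the scalar instance of the landed `…StubInitialForm.weightedHomogeneousComponent_det_of_le`.)
* **Stub 3 (`orbitDimensionBound_three`, LANDED p159221 — reshape 1):** the slice `n = 3` of the crux
  itself: `dc(per_3) = 7 = 2³ - 1` (Alper–Bogart–Velasco, tree) and Grenet's `7 × 7` representation is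
  two-sided-torus equivariant (tree), so padding it serves every `m ≥ 7` with `r = 0`.  The same file
  (`Theorems/FreeSubtorusOrbitDimensionBoundSlices.lean`) proves the slice `m ≥ 2ⁿ - 1` for every `n ≥ 1`
  (`concl_of_two_pow_le`), used below to cut stub 4 down to the sub-Grenet sizes.
* **Stub 4 (`stub_smallFace`, OPEN — the crux's per-specific content; reshape 2: `m ≤ 2ⁿ - 2` only):**
  for `n ≥ 4` and every size-`m` representation `A` of `per_n` with `m + 2 ≤ 2ⁿ` (a SUB-GRENET size)
  there are a size-`m` representation `B`, a cocharacter `μ` with a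
  sub-potential `(a,b)` for `B`, and `r ≤ n/2` ADMISSIBLE relations `Λ` with potentials `α, β : Fin m → M`
  such that the `μ`-TIGHT PART of `B` is tight modulo `ℤΛ` (the face of the formal matching polytope of
  `B` exposed by `μ` is lattice-tight for a lattice of rank `≤ n/2` inside the admissible hyperplanes).
  This is EXACTLY the open range `n ≥ 4`, `dc(per_n) ≤ m ≤ 2ⁿ - 2` (refuter ATTACK.md): no representation
  of `per_n` below Grenet's size `2ⁿ - 1` is known for any `n ≥ 4` (`9 ≤ dc(per_4) ≤ 15`), so the
  hypothesis may well be void — the stub (hence the crux) follows from Grenet optimality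
  `dc(per_n) = 2ⁿ - 1`, and conversely an equivariant representation in this range with `Λ`
  saturated yields the stub with `μ = 0` (one generic torus element, generalised eigenspaces).
* **Composition (`OrbitDimensionBound_of`, sorry-free):** at `n = 3` stub 3 (tree); for `n ≥ 4` and
  `m ≥ 2ⁿ - 1` the tree's `concl_of_two_pow_le`; for `n ≥ 4`, `m ≤ 2ⁿ - 2` stub 4 gives `B, μ, a, b, Λ, α, β`; stub 2
  gives the initial form `B'` (a size-`m` representation, supports inside `B`'s, `μ`-tight), so every
  monomial of `B'` is a `μ`-tight monomial of `B`, hence tight modulo `ℤΛ`; stub 1 makes `B'`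
  `T_Λ`-equivariant with the SAME admissible `Λ`, `r ≤ n/2` — the crux BY NAME.

Why a genuine cut.  Stubs 1–2 hold for every polynomial that is `T'`-semi-invariant in place of
`per_n` and are finite linear algebra on ONE matrix (no GIT quotient, no closed orbits, no
Derksen–Makam separation — contrast line `birth`); stub 3 isolates the per-specific number (the
dimension of the lattice-tight face) in a form a disprover can attack on explicit matrices.

## Shape (skeleton audit by-name rule) — reshape 3 (2026-08-17, continuation lead c1)
* `Stmt.stub_smallFace` — the one OPEN crux-content stub statement as a precise `Prop`, named like the stub;
* stubs 1–3 are the tree theorems `FreeSubtorusOrbitDimensionBound.stub_tightModLatticeLifts` (p158705),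
  `…stub_initialFormAccumulates` (p158723), `…orbitDimensionBound_three` / `…concl_of_two_pow_le` (p159221),
  used inside `OrbitDimensionBound_of`; the sorried theorem `stub_smallFace` carries the crux's open content;
* reshape 3 (§4) registered four PROVABLE calibration stubs `stub_perpBasis`, `stub_eigenGauge`, `stub_degMap`,
  `stub_saturationBasis` (pure linear algebra / unique factorisation) — all four LANDED (wave 1) and are imported —
  and proves from them, sorry-free,
  `smallFace_of_equivariant` (T_Λ-equivariant ⇒ tight modulo a ℤ-basis of Λ_sat after a constant gauge),
  `smallFace_of_orbitDimensionBound : crux → Stmt.stub_smallFace` and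
  `orbitDimensionBound_iff_smallFace : crux ↔ Stmt.stub_smallFace` — the converse calibration as a theorem;
* `OrbitDimensionBound_of` — the composition, real proof; `OrbitDimensionBound_proof` — the crux by name.
-/

namespace Summit.ValiantsHypothesis.ValiantsHypothesis.Cruxes.OrbitDimensionBound.Sketch

open Matrix MvPolynomial Finset
open Literature.Computability.AlgebraicComplexity LRPencil

-- `Summit.ValiantsHypothesis.ValiantsHypothesis.…` is the tree's mandated single-conjunct layout (Sub = Summit).
set_option linter.dupNamespace false

noncomputable section

/-! ## §1 The open stub statement as a `Prop` (named like the registered stub) -/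

/-- Statement of stub 4 (`stub_smallFace`) — **some size-`m` representation has a lattice-tight face
of codimension `≤ n/2` (OPEN: the crux's per-specific content).**  For `n ≥ 4` and every affine
determinantal representation `A` of `per_n` of a sub-Grenet size `m ≤ 2ⁿ - 2` there are a representation `B` of size `m`, a
cocharacter `μ` with a sub-potential `(a,b)` for `B`, `r ≤ n/2` ADMISSIBLE relations `Λ` (zero row-sum,
zero column-sum) and potentials `α, β : Fin m → ℤ^(Fin n ⊕ Fin n)` such that the `μ`-TIGHT part of `B`
is tight modulo `ℤΛ`: a `μ`-tight constant at `(i,j)` forces `α i + β j ∈ ℤΛ`, a `μ`-tight variable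
`x_p` at `(i,j)` forces `α i + β j - e_p ∈ ℤΛ`.
[cite: LandsbergRessayre2017, §2 Q2.2] [cite: Bialynickibirula1973, Thm. 4.1] -/
def Stmt.stub_smallFace : Prop :=
  ∀ n : ℕ, 4 ≤ n → ∀ (m : ℕ), m + 2 ≤ 2 ^ n → ∀ (A : Matrix (Fin m) (Fin m) (MvPolynomial (Fin n × Fin n) ℂ)),
    Literature.Computability.AlgebraicComplexity.IsAffineDetRepr
        (Literature.Computability.AlgebraicComplexity.perPoly (Fin n) ℂ) A →
    ∃ (B : Matrix (Fin m) (Fin m) (MvPolynomial (Fin n × Fin n) ℂ))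
      (μ : Fin n ⊕ Fin n → ℤ) (a b : Fin m → ℤ)
      (r : ℕ) (Λ : Fin r → (Fin n ⊕ Fin n) → ℤ) (α β : Fin m → (Fin n ⊕ Fin n) → ℤ),
      Literature.Computability.AlgebraicComplexity.IsAffineDetRepr
          (Literature.Computability.AlgebraicComplexity.perPoly (Fin n) ℂ) B ∧
      r ≤ n / 2 ∧
      (∀ i, (∑ k, Λ i (Sum.inl k)) = 0 ∧ (∑ l, Λ i (Sum.inr l)) = 0) ∧
      (∀ i j, Literature.Computability.AlgebraicComplexity.constPart B i j ≠ 0 → a i + b j ≤ 0) ∧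
      (∀ i j (p : Fin n × Fin n),
        Literature.Computability.AlgebraicComplexity.LRPencil.coeffMat B p i j ≠ 0 →
        a i + b j ≤ μ (Sum.inl p.1) + μ (Sum.inr p.2)) ∧
      ∑ i, a i + ∑ j, b j = ∑ q, μ q ∧
      (∀ i j, Literature.Computability.AlgebraicComplexity.constPart B i j ≠ 0 → a i + b j = 0 →
        ∃ z : Fin r → ℤ, α i + β j = ∑ t, z t • Λ t) ∧
      (∀ i j (p : Fin n × Fin n),
        Literature.Computability.AlgebraicComplexity.LRPencil.coeffMat B p i j ≠ 0 →
        a i + b j = μ (Sum.inl p.1) + μ (Sum.inr p.2) →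
        ∃ z : Fin r → ℤ,
          α i + β j - ((Pi.single (Sum.inl p.1) 1 : Fin n ⊕ Fin n → ℤ) + Pi.single (Sum.inr p.2) 1) =
            ∑ t, z t • Λ t)

/-! ## §2 The registered OPEN stub (the ONLY sorry of this file; stubs 1–3 are imported tree theorems) -/

/-- **Registered stub 4 = `Stmt.stub_smallFace`** (some size-`m` representation of `per_n` has a
`μ`-exposed face that is tight modulo an admissible lattice with `r ≤ n/2` generators; OPEN — the
crux's per-specific content). [cite: LandsbergRessayre2017, §2 Q2.2] -/
theorem stub_smallFace :
    ∀ n : ℕ, 4 ≤ n → ∀ (m : ℕ), m + 2 ≤ 2 ^ n → ∀ (A : Matrix (Fin m) (Fin m) (MvPolynomial (Fin n × Fin n) ℂ)),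
    Literature.Computability.AlgebraicComplexity.IsAffineDetRepr
        (Literature.Computability.AlgebraicComplexity.perPoly (Fin n) ℂ) A →
    ∃ (B : Matrix (Fin m) (Fin m) (MvPolynomial (Fin n × Fin n) ℂ))
      (μ : Fin n ⊕ Fin n → ℤ) (a b : Fin m → ℤ)
      (r : ℕ) (Λ : Fin r → (Fin n ⊕ Fin n) → ℤ) (α β : Fin m → (Fin n ⊕ Fin n) → ℤ),
      Literature.Computability.AlgebraicComplexity.IsAffineDetRepr
          (Literature.Computability.AlgebraicComplexity.perPoly (Fin n) ℂ) B ∧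
      r ≤ n / 2 ∧
      (∀ i, (∑ k, Λ i (Sum.inl k)) = 0 ∧ (∑ l, Λ i (Sum.inr l)) = 0) ∧
      (∀ i j, Literature.Computability.AlgebraicComplexity.constPart B i j ≠ 0 → a i + b j ≤ 0) ∧
      (∀ i j (p : Fin n × Fin n),
        Literature.Computability.AlgebraicComplexity.LRPencil.coeffMat B p i j ≠ 0 →
        a i + b j ≤ μ (Sum.inl p.1) + μ (Sum.inr p.2)) ∧
      ∑ i, a i + ∑ j, b j = ∑ q, μ q ∧
      (∀ i j, Literature.Computability.AlgebraicComplexity.constPart B i j ≠ 0 → a i + b j = 0 →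
        ∃ z : Fin r → ℤ, α i + β j = ∑ t, z t • Λ t) ∧
      (∀ i j (p : Fin n × Fin n),
        Literature.Computability.AlgebraicComplexity.LRPencil.coeffMat B p i j ≠ 0 →
        a i + b j = μ (Sum.inl p.1) + μ (Sum.inr p.2) →
        ∃ z : Fin r → ℤ,
          α i + β j - ((Pi.single (Sum.inl p.1) 1 : Fin n ⊕ Fin n → ℤ) + Pi.single (Sum.inr p.2) 1) =
            ∑ t, z t • Λ t) := by
  sorry

/-! ## §3 The composition (kernel-checked, sorry-free) -/

/-- **The crux from the four stubs** (real proof).  Given `n ≥ 3`, `m` and a representation `A`: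
at `n = 3` stub 3 (tree) is the claim; for `m ≥ 2ⁿ - 1` pad Grenet (tree, `concl_of_two_pow_le`);
for `n ≥ 4`, `m ≤ 2ⁿ - 2` stub 4 gives `B, μ, a, b` (a sub-potential) and an
admissible `Λ` (`r ≤ n/2`) with potentials `α, β` making the `μ`-tight part of `B` tight modulo `ℤΛ`;
stub 2 gives the initial form `B'` of `B` along `(μ, a, b)` — a size-`m` representation whose monomials
are `μ`-tight monomials of `B` (supports shrink + tightness), hence tight modulo `ℤΛ`; stub 1 makes `B'`
`T_Λ`-equivariant with the same `r, Λ` — the crux BY NAME.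
[cite: LandsbergRessayre2017, Def. 1.3] [cite: Bialynickibirula1973, Thm. 4.1] -/
theorem OrbitDimensionBound_of :
    Stmt.stub_smallFace →
      Summit.ValiantsHypothesis.ValiantsHypothesis.Theses.FreeSubtorus.OrbitDimensionBound := by
  intro h₄
  -- stubs 1–3 are tree theorems (landed from this line)
  have h₁ := Summit.ValiantsHypothesis.ValiantsHypothesis.Theorems.FreeSubtorusOrbitDimensionBound.stub_tightModLatticeLifts
  have h₂ := Summit.ValiantsHypothesis.ValiantsHypothesis.Theorems.FreeSubtorusOrbitDimensionBound.stub_initialFormAccumulates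
  have h₃ := Summit.ValiantsHypothesis.ValiantsHypothesis.Theorems.FreeSubtorusOrbitDimensionBound.orbitDimensionBound_three
  unfold Stmt.stub_smallFace at h₄
  unfold Summit.ValiantsHypothesis.ValiantsHypothesis.Theses.FreeSubtorus.OrbitDimensionBound
  intro n hn m A hA
  rcases Nat.lt_or_ge n 4 with hlt | h4
  · -- the slice `n = 3` (tree)
    obtain rfl : n = 3 := by omega
    exact h₃ m A hA
  rcases Nat.lt_or_ge m (2 ^ n - 1) with hm | hm
  swap
  · -- Grenet's sizes `m ≥ 2ⁿ - 1` (tree): pad the two-sided-torus-equivariant representation, `r = 0`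
    exact Summit.ValiantsHypothesis.ValiantsHypothesis.Theorems.FreeSubtorusOrbitDimensionBound.concl_of_two_pow_le
      (by omega) hm
  -- `n ≥ 4`, sub-Grenet size `m ≤ 2ⁿ - 2`. Stub 4: the representation `B`, the exposing cocharacter `μ`
  -- with sub-potential `(a,b)`, the admissible lattice `Λ` and the potentials `α, β`
  obtain ⟨B, μ, a, b, r, Λ, α, β, hB, hr, hΛ, h0, h1, hsum, ht0, ht1⟩ := h₄ n h4 m (by omega) A hA
  -- stub 2: the initial form `B'` of `B` along `(μ, a, b)`
  obtain ⟨B', hB', hsupp, htc, htv⟩ := h₂ n m B μ a b hB h0 h1 hsum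
  refine ⟨B', r, Λ, hr, hΛ, ?_⟩
  -- stub 1 on `B'`: its support is tight modulo `ℤΛ`
  refine h₁ n m r Λ B' α β hB' (fun i j hij => ?_) (fun i j p hij => ?_)
  · -- a constant of `B'` at `(i,j)` is a `μ`-tight constant of `B`
    have hij' : Literature.Computability.AlgebraicComplexity.constPart B i j ≠ 0 := by
      rw [constPart_apply, constantCoeff_eq, ← mem_support_iff] at hij ⊢
      exact hsupp i j hij
    exact ht0 i j hij' (htc i j hij)
  · -- a variable `x_p` of `B'` at `(i,j)` is a `μ`-tight variable of `B`
    have hij' : Literature.Computability.AlgebraicComplexity.LRPencil.coeffMat B p i j ≠ 0 := by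
      rw [coeffMat_apply, ← mem_support_iff] at hij ⊢
      exact hsupp i j hij
    exact ht1 i j p hij' (htv i j p hij)

/-! ## §4 Converse calibration (reshape 3, continuation lead c1): four calibration stubs — ALL LANDED in wave 1
(`stub_perpBasis` p162435, `stub_eigenGauge` p162439, `stub_degMap` p162587, `stub_saturationBasis` p162636,
tree `Theorems/FreeSubtorusOrbitDimensionBoundStub{PerpBasis,EigenGauge,DegMap,SaturationBasis}.lean`, imported) —
and the converse `crux → Stmt.stub_smallFace` — LANDED as tree theorem `…FreeSubtorusOrbitDimensionBoundConverse.lean` (p163364: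
`smallFace_of_equivariant`, `smallFace_of_orbitDimensionBound`, `orbitDimensionBound_of_smallFace`, `orbitDimensionBound_iff_smallFace`),
so that the single open stub is kernel-certified to be the crux

The mechanism ("one generic element of `T_Λ°`, one exact lift, generalised eigenspaces, degrees modulo
the saturation"): for relations `Λ` take an integer family `b₁,…,b_s` spanning the rational orthogonal
complement of `ℤΛ` (stub `stub_perpBasis`, with the double-annihilator property), distinct primes
`p₁,…,p_s`, and the torus element `t₀ = (d,e)`, `d_k = ∏_j p_j^{b_j(inl k)}`, `e_l = ∏_j p_j^{b_j(inr l)}`;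
it satisfies every relation of `Λ` (so `t₀ ∈ T_Λ`) and its character values
`χ_w(t₀) = ∏_j p_j^{⟨b_j,w⟩}` (`w ∈ ℤ^(Fin n ⊕ Fin n)`) satisfy `χ_w(t₀) = 1 ⇔ w ∈ Λ_sat` (unique
factorisation).  ONE exact lift `B(t₀·x) = P B Q⁻¹` gives `P B₀ = B₀ Q` and `P B_v = χ_{wt v}(t₀) B_v Q`;
a constant gauge adapted to the generalised eigenspaces of `P` and `Q` (stub `stub_eigenGauge`) makes every
surviving entry carry an eigenvalue identity `λ_i = χ_{wt v}(t₀) μ_j` (`λ_i = μ_j` for constants); the degree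
map of stub `stub_degMap` (classes of `ℂˣ` modulo `χ(ℤ^(Fin n ⊕ Fin n))`, additive modulo `ker b = Λ_sat`)
turns these into `α_i + β_j - wt v ∈ Λ_sat`, and stub `stub_saturationBasis` writes `Λ_sat = ℤΛ'` with
`r' ≤ r` admissible generators. -/

/-- **The converse calibration: the crux implies the open stub** — the tree theorem
`FreeSubtorusOrbitDimensionBound.smallFace_of_orbitDimensionBound` (p163364, built on the four landed
calibration stubs via `smallFace_of_equivariant`), restated against `Stmt.stub_smallFace`.
[cite: LandsbergRessayre2017, §2 Q2.2] -/
theorem smallFace_of_orbitDimensionBound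
    (h : Summit.ValiantsHypothesis.ValiantsHypothesis.Theses.FreeSubtorus.OrbitDimensionBound) :
    Stmt.stub_smallFace := by
  unfold Stmt.stub_smallFace
  exact Summit.ValiantsHypothesis.ValiantsHypothesis.Theorems.FreeSubtorusOrbitDimensionBound.smallFace_of_orbitDimensionBound h

/-- **`OrbitDimensionBound ↔ Stmt.stub_smallFace`** (tree: `…FreeSubtorusOrbitDimensionBound.orbitDimensionBound_iff_smallFace`,
p163364): the line `Sketch` has no slack in either direction — its single open stub IS the crux's open content.
[cite: LandsbergRessayre2017, §2 Q2.2] -/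
theorem orbitDimensionBound_iff_smallFace :
    Summit.ValiantsHypothesis.ValiantsHypothesis.Theses.FreeSubtorus.OrbitDimensionBound ↔
      Stmt.stub_smallFace :=
  ⟨smallFace_of_orbitDimensionBound, OrbitDimensionBound_of⟩

/-- **THE SKELETON: the crux BY NAME, modulo exactly the one registered open stub** — stubs 1–3 are
landed tree theorems, stub 4 the sorried theorem of this file (the compiler checks that the `Stmt` copy
and the stub statement agree). [cite: LandsbergRessayre2017, §2] -/
theorem OrbitDimensionBound_proof :
    Summit.ValiantsHypothesis.ValiantsHypothesis.Theses.FreeSubtorus.OrbitDimensionBound :=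
  OrbitDimensionBound_of stub_smallFace

/-! ## §5 The product-rank ladder, rung `j = 1`, all `n` (reshape 5, continuation lead c2)

Why this is here.  By Gesmundo–Ghosal–Ikenmeyer–Lysikov (arXiv:2205.02149, Thm 12 and Prop 9) a
homogeneous ABP computing a form `F` of degree `d` has at least `Σ_{j=1}^{d-1} str_j(F)` vertices,
`str_j` = `j`-restricted strength (minimal `r` with `F = Σ_{k<r} G_k H_k`, `deg G_k = j`), and
`str_1(F) = sr(F) ≤ r` iff the hypersurface `{F = 0}` contains a linear subspace of codimension `r`.
Through the landed necessary condition `homothetyLifts_of_orbitDimensionBound` (homotheties lie in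
every admissible `T_Λ`), the crux at `n` forces some OPTIMAL representation of `per_n` to be graded by
degree, i.e. a homogeneous ABP with `dc(per_n) - 1` internal vertices, so the crux at `n = 4` reads
`dc(per_4) - 1 ≥ sr(per_4) + str_2(per_4) + sr(per_4)`.  This section proves the rung `j = 1` for ALL
`n`: **a linear subspace of `M_n(ℂ)` on which `per_n` vanishes identically has dimension `≤ n² - n`**
(new as far as searched: the determinant case is Dieudonné 1949 / [Landsberg 2017, Lemma 6.6.1.4];
presearch in NOTES.md), hence `sr(per_n) = n` (Laplace along one row is optimal) and both end levels
of every homogeneous ABP of `per_n` have `≥ n` vertices.  The pivotal next number `str_2(per_4)`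
(`= 3` for `det_4` by the Pfaffian identity, arXiv:2509.06294 Thm 3; `≤ 6` for `per_4` by two-row
Laplace) is attacked numerically (kit j027860/j027861) — `str_2(per_4) = 6` would give
`himmc(per_4) = 15` and `crux@4 ⟺ dc(per_4) = 15`.

Proof of the subspace bound.  (a) PRODUCT REDUCTION: for `U ≤ M_n(ℂ)` with `per|_U ≡ 0` put
`F_i = {X ∈ U : rows < i vanish}` and `K_i = row_i(F_i) ≤ ℂⁿ`; then `Σ_i dim K_i = dim U`
(`stub_filtrationFinrank`, telescoping rank–nullity) and `per` vanishes on EVERY matrix with row `i`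
in `K_i` (`productVanish`: induction on `i` using that `t ↦ per(k_{<i}; k_i; X_{>i} + t Y_{>i})`
vanishes identically, so its top coefficient `per(k_{≤ i}; Y_{>i})` vanishes —
`stub_multilinearVanish` applied to the permanent as a multilinear function of the rows).
(b) MULTILINEAR BOUND (`stub_perProductBound`, induction on `n`): if `Σ dim K_i ≥ n² - n + 1` some
`K_{i₀} = ℂⁿ`; expanding along row `i₀ = e_j` shows `per_{n-1}` vanishes on the products of the
projections `K_i^{(j)}` (delete coordinate `j`), so by induction `Σ_{i ≠ i₀} dim K_i^{(j)} ≤ (n-1)(n-2)`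
for each `j`; but `Σ_j dim K_i^{(j)} ≥ n·dim K_i - #{j : e_j ∈ K_i} ≥ (n-1) dim K_i`, and summing gives
`(n-1)³ ≤ n(n-1)(n-2)`, absurd.  (c) `sr(per_n) = n` (`stub_sliceRankOfBound`): `per_n = Σ_{t<w} ℓ_t h_t`
with linear forms `ℓ_t` makes `per_n` vanish on `⋂ ker ℓ_t`, of dimension `≥ n² - w`. -/

/-- **Registered stub `stub_multilinearVanish`** (reshape 5; pure multilinear algebra).  If a
multilinear form `f` satisfies `f (x + t • y) = 0` for every scalar `t`, and `y` is supported in `S`,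
then the "top coefficient" `f (S.piecewise y x)` (arguments `y i` for `i ∈ S`, `x i` for `i ∉ S`)
vanishes: expand `f (x + t • y) = Σ_T t^{|T|} f (T.piecewise y x)` (`MultilinearMap.map_add_univ`,
`map_piecewise_smul`), note that the terms with `T ⊄ S` vanish (`map_coord_zero`), and read off the
coefficient of `t^{|S|}` of a polynomial vanishing on all of `ℂ` (`Polynomial.funext`). [folklore] -/
theorem stub_multilinearVanish :
    ∀ {ι : Type} [Fintype ι] [DecidableEq ι] {V : Type} [AddCommGroup V] [Module ℂ V]
      (f : MultilinearMap ℂ (fun _ : ι => V) ℂ) (x y : ι → V) (S : Finset ι),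
      (∀ i, i ∉ S → y i = 0) → (∀ t : ℂ, f (x + t • y) = 0) → f (S.piecewise y x) = 0 :=
  -- LANDED p173040 (wave 1)
  @Summit.ValiantsHypothesis.ValiantsHypothesis.Theorems.FreeSubtorusOrbitDimensionBound.stub_multilinearVanish

/-- **Registered stub `stub_filtrationFinrank`** (reshape 5; linear algebra).  For a subspace `U`
of `Fin n → W` and the filtration `F_i = {v ∈ U : v j = 0 for all j < i}`, the dimensions of the
`i`-th coordinate images `K_i = proj_i (F_i)` add up to `dim U` (rank–nullity: the kernel of
`proj_i` on `F_i` is `F_{i+1}`, and `F_n = 0`; telescoping). [folklore] -/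
theorem stub_filtrationFinrank :
    ∀ {n : ℕ} {W : Type} [AddCommGroup W] [Module ℂ W] [FiniteDimensional ℂ W]
      (U : Submodule ℂ (Fin n → W)),
      Module.finrank ℂ U =
        ∑ i : Fin n, Module.finrank ℂ
          ((U ⊓ ⨅ j ∈ Finset.univ.filter (fun j : Fin n => j < i),
              LinearMap.ker (LinearMap.proj j : (Fin n → W) →ₗ[ℂ] W)).map
            (LinearMap.proj i : (Fin n → W) →ₗ[ℂ] W)) :=
  -- LANDED p173141 (wave 1)
  @Summit.ValiantsHypothesis.ValiantsHypothesis.Theorems.FreeSubtorusOrbitDimensionBound.stub_filtrationFinrank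

/-- **Registered stub `stub_perProductBound`** (reshape 5; the multilinear heart).  If row
subspaces `K_0, …, K_{n-1} ≤ ℂⁿ` have the property that EVERY matrix with row `i` in `K_i`
(all `i`) has permanent zero, then `Σ_i dim K_i ≤ n² - n`.  Induction on `n`: either every
`dim K_i ≤ n - 1`, or some `K_{i₀} = ℂⁿ`; then with row `i₀ = e_j` the Laplace expansion
(`Matrix.permanent_eq_sum_row`) shows that `per_{n-1}` vanishes on the products of the projections
`K_i ∘ j.succAbove` (`i ≠ i₀`), the induction hypothesis bounds `Σ_{i ≠ i₀} dim (K_i ∘ j.succAbove)`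
by `(n-1)(n-2)` for each `j`, while `Σ_j dim (K_i ∘ j.succAbove) ≥ n dim K_i - #{j : e_j ∈ K_i}
≥ (n-1) dim K_i`; summing over `j` gives `(n-1)·Σ_{i≠i₀} dim K_i ≤ n(n-1)(n-2)`, i.e.
`Σ_{i≠i₀} dim K_i ≤ n² - 2n` (`n = 1` separately: `K_0 = ℂ` contradicts `per (1) = 1`). [folklore] -/
theorem stub_perProductBound :
    ∀ (n : ℕ) (K : Fin n → Submodule ℂ (Fin n → ℂ)),
      (∀ X : Fin n → Fin n → ℂ, (∀ i, X i ∈ K i) → (Matrix.of X).permanent = 0) →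
      ∑ i, Module.finrank ℂ (K i) + n ≤ n * n :=
  -- LANDED p173236 (wave 1)
  Summit.ValiantsHypothesis.ValiantsHypothesis.Theorems.FreeSubtorusOrbitDimensionBound.stub_perProductBound

/-- **Registered stub `stub_sliceRankOfBound`** (reshape 5; from the subspace bound to the slice
rank).  If every subspace of `M_n(ℂ)` on which `per_n` vanishes has dimension `≤ n² - n`, then any
decomposition `per_n = Σ_{t<w} ℓ_t h_t` with LINEAR forms `ℓ_t` has `w ≥ n`: `per_n` vanishes on the
common kernel `⋂_t ker ℓ_t` (evaluate the identity, `eval_perPoly`), a subspace of dimension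
`≥ n² - w` (each `ℓ_t` is one linear functional `X ↦ Σ_p coeff(x_p) ℓ_t · X_p`). GGIL22 Prop. 9.
[cite: arXiv:2205.02149, Prop. 9] -/
theorem stub_sliceRankOfBound :
    ∀ (n : ℕ), (∀ U : Submodule ℂ (Fin n → Fin n → ℂ),
        (∀ X ∈ U, (Matrix.of X).permanent = 0) → Module.finrank ℂ U + n ≤ n * n) →
      ∀ (w : ℕ) (ℓ h : Fin w → MvPolynomial (Fin n × Fin n) ℂ),
        (∀ t, (ℓ t).IsHomogeneous 1) →
        Literature.Computability.AlgebraicComplexity.perPoly (Fin n) ℂ = ∑ t, ℓ t * h t → n ≤ w :=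
  -- LANDED p173209 (wave 1)
  Summit.ValiantsHypothesis.ValiantsHypothesis.Theorems.FreeSubtorusOrbitDimensionBound.stub_sliceRankOfBound

/-! ### Assembly of §5 (lead): the permanent as a multilinear function of the rows, the product
reduction, the subspace bound and `sr(per_n) = n` -/

/-- The permanent of an `n × n` matrix as a multilinear function of its `n` rows
(row-additivity `permanent_updateRow_add` is replayed from the defining sum; homogeneity is
Mathlib's `Matrix.permanent_updateRow_smul`). [folklore] -/
def perRows (n : ℕ) : MultilinearMap ℂ (fun _ : Fin n => Fin n → ℂ) ℂ where
  toFun X := (Matrix.of X).permanent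
  map_update_add' := by
    intro inst X i u v
    have h := Literature.LinearAlgebra.Matrix.permanent_updateRow_add
      (show Matrix (Fin n) (Fin n) ℂ from X) i u v
    simp only [Matrix.updateRow] at h
    convert h
  map_update_smul' := by
    intro inst X i c u
    have h := Matrix.permanent_updateRow_smul (show Matrix (Fin n) (Fin n) ℂ from X) i c u
    simp only [Matrix.updateRow] at h
    rw [smul_eq_mul]
    convert h

/-- The row filtration of a subspace `U` of `n × n` matrices: `rowFilt U i = {X ∈ U : X j = 0 for
all j < i}` (so `rowFilt U 0 = U`). [folklore] -/
def rowFilt {n : ℕ} (U : Submodule ℂ (Fin n → Fin n → ℂ)) (i : Fin n) :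
    Submodule ℂ (Fin n → Fin n → ℂ) :=
  U ⊓ ⨅ j ∈ Finset.univ.filter (fun j : Fin n => j < i),
    LinearMap.ker (LinearMap.proj j : (Fin n → Fin n → ℂ) →ₗ[ℂ] (Fin n → ℂ))

/-- The `i`-th row space of the product reduction: `rowSpace U i = row_i (rowFilt U i) ≤ ℂⁿ`.
[folklore] -/
def rowSpace {n : ℕ} (U : Submodule ℂ (Fin n → Fin n → ℂ)) (i : Fin n) : Submodule ℂ (Fin n → ℂ) :=
  (rowFilt U i).map (LinearMap.proj i : (Fin n → Fin n → ℂ) →ₗ[ℂ] (Fin n → ℂ))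

theorem mem_rowFilt_iff {n : ℕ} (U : Submodule ℂ (Fin n → Fin n → ℂ)) (i : Fin n)
    (X : Fin n → Fin n → ℂ) : X ∈ rowFilt U i ↔ X ∈ U ∧ ∀ j : Fin n, j < i → X j = 0 := by
  simp [rowFilt, Submodule.mem_inf, Submodule.mem_iInf, LinearMap.mem_ker]

/-- **Product reduction, vanishing half** (lead, from `stub_multilinearVanish`): if `per` vanishes
on `U`, it vanishes on EVERY matrix whose `i`-th row lies in the `i`-th row space `rowSpace U i`
of the filtration (induction on the number of frozen rows: `t ↦ per(k_{<m}; W_m + tY)` vanishes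
identically for `W_m, Y` in the `m`-th filtration step, and its top coefficient in the rows `> m` is
the next instance). [folklore] -/
theorem productVanish {n : ℕ} (U : Submodule ℂ (Fin n → Fin n → ℂ))
    (hU : ∀ X ∈ U, (Matrix.of X).permanent = 0) (k : Fin n → Fin n → ℂ)
    (hk : ∀ i, k i ∈ rowSpace U i) : (Matrix.of k).permanent = 0 := by
  classical
  -- witnesses `W i ∈ rowFilt U i` with `W i i = k i`
  have hW : ∀ i : Fin n, ∃ W : Fin n → Fin n → ℂ, W ∈ U ∧ (∀ j : Fin n, j < i → W j = 0) ∧ W i = k i := by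
    intro i
    obtain ⟨W, hWF, hWi⟩ := Submodule.mem_map.1 (hk i)
    exact ⟨W, ((mem_rowFilt_iff U i W).1 hWF).1, ((mem_rowFilt_iff U i W).1 hWF).2, hWi⟩
  choose W hWU hWz hWk using hW
  -- the frozen matrices `Z m Y = (k_{<m}; Y_{≥ m})`
  let Z : ℕ → (Fin n → Fin n → ℂ) → (Fin n → Fin n → ℂ) := fun m Y i => if (i : ℕ) < m then k i else Y i
  have hZ : ∀ m : ℕ, m ≤ n → ∀ Y ∈ U, (∀ j : Fin n, (j : ℕ) < m → Y j = 0) →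
      (Matrix.of (Z m Y)).permanent = 0 := by
    intro m
    induction m with
    | zero =>
      intro _ Y hY _
      have : Z 0 Y = Y := by funext i; simp [Z]
      rw [this]; exact hU Y hY
    | succ m ih =>
      intro hm Y hY hY0
      have hmn : m < n := Nat.lt_of_succ_le hm
      set im : Fin n := ⟨m, hmn⟩ with him
      -- `x = Z m (W im)`, `y = (0_{≤ m}; Y_{> m})`, `S = {i : m < i}`
      let x : Fin n → Fin n → ℂ := Z m (W im)
      let y : Fin n → Fin n → ℂ := fun i => if (i : ℕ) ≤ m then 0 else Y i
      let S : Finset (Fin n) := Finset.univ.filter (fun i : Fin n => m < (i : ℕ))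
      have hyS : ∀ i, i ∉ S → y i = 0 := by
        intro i hi
        have : ¬ m < (i : ℕ) := by simpa [S] using hi
        simp [y, Nat.le_of_not_lt this]
      have hline : ∀ t : ℂ, perRows n (x + t • y) = 0 := by
        intro t
        have hmem : W im + t • Y ∈ U := U.add_mem (hWU im) (U.smul_mem t hY)
        have hrows : ∀ j : Fin n, (j : ℕ) < m → (W im + t • Y) j = 0 := by
          intro j hj
          have h1 : W im j = 0 := hWz im j (by rw [Fin.lt_def]; simpa [him] using hj)
          have h2 : Y j = 0 := hY0 j (Nat.lt_succ_of_lt hj)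
          simp [h1, h2]
        have h := ih hmn.le (W im + t • Y) hmem hrows
        have hxy : Z m (W im + t • Y) = x + t • y := by
          funext i
          by_cases hi : (i : ℕ) < m
          · simp [Z, x, y, hi, hi.le]
          · by_cases hi' : (i : ℕ) = m
            · have hYi : Y i = 0 := hY0 i (by omega)
              simp [Z, x, y, hi', hYi]
            · have hgt : ¬ (i : ℕ) ≤ m := by omega
              simp [Z, x, y, hi, hgt]
        have : perRows n (x + t • y) = (Matrix.of (Z m (W im + t • Y))).permanent := by
          rw [hxy]; rfl
        rw [this]; exact h
      have hvan := Summit.ValiantsHypothesis.ValiantsHypothesis.Cruxes.OrbitDimensionBound.Sketch.stub_multilinearVanish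
        (perRows n) x y S hyS hline
      have hpw : S.piecewise y x = Z (m + 1) Y := by
        funext i
        by_cases hi : m < (i : ℕ)
        · have hiS : i ∈ S := by simp [S, hi]
          rw [Finset.piecewise_eq_of_mem _ _ _ hiS]
          have h1 : ¬ (i : ℕ) ≤ m := by omega
          have h2 : ¬ (i : ℕ) < m + 1 := by omega
          simp [y, Z, h1, h2]
        · have hiS : i ∉ S := by simp [S, hi]
          rw [Finset.piecewise_eq_of_notMem _ _ _ hiS]
          by_cases hi' : (i : ℕ) < m
          · have h2 : (i : ℕ) < m + 1 := by omega
            simp [x, Z, hi', h2]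
          · have hieq : i = im := Fin.ext (by simp [him]; omega)
            have h2 : (i : ℕ) < m + 1 := by omega
            have hx : x i = k i := by
              show (if (i : ℕ) < m then k i else W im i) = k i
              rw [if_neg hi', hieq, hWk im]
            rw [hx]; simp [Z, h2]
      have : (Matrix.of (Z (m + 1) Y)).permanent = perRows n (S.piecewise y x) := by
        rw [hpw]; rfl
      rw [this]; exact hvan
  have hfin := hZ n le_rfl 0 U.zero_mem (fun _ _ => rfl)
  have hZn : Z n 0 = k := by funext i; simp [Z, i.isLt]
  rwa [hZn] at hfin

/-- **Theorem (all `n`): a linear subspace of `M_n(ℂ)` on which the permanent vanishes identically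
has dimension at most `n² - n`** — written `dim U + n ≤ n²`.  Product reduction
(`stub_filtrationFinrank`, `productVanish`) and the multilinear bound (`stub_perProductBound`).
Equality holds for the matrices with a zero row (or column).  The determinant analogue is
Dieudonné's lemma [Landsberg 2017, Lemma 6.6.1.4]. [folklore] -/
theorem perVanishingSubspace_bound (n : ℕ) (U : Submodule ℂ (Fin n → Fin n → ℂ))
    (hU : ∀ X ∈ U, (Matrix.of X).permanent = 0) : Module.finrank ℂ U + n ≤ n * n := by
  have h1 : Module.finrank ℂ U = ∑ i : Fin n, Module.finrank ℂ (rowSpace U i) :=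
    stub_filtrationFinrank U
  have h2 := stub_perProductBound n (rowSpace U) (fun X hX => productVanish U hU X hX)
  rw [h1]; exact h2

/-- **Corollary: `sr(per_n) = n` — the slice rank (1-restricted strength) of the permanent is `n`.**
Any decomposition `per_n = Σ_{t<w} ℓ_t h_t` with linear forms `ℓ_t` has `w ≥ n` (and Laplace
expansion along a row attains `w = n`).  With GGIL22 Thm 12, both end levels of every homogeneous
ABP computing `per_n` have at least `n` vertices. [cite: arXiv:2205.02149, Prop. 9, Thm. 12] -/
theorem sliceRank_perPoly (n w : ℕ) (ℓ h : Fin w → MvPolynomial (Fin n × Fin n) ℂ)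
    (hℓ : ∀ t, (ℓ t).IsHomogeneous 1)
    (hper : Literature.Computability.AlgebraicComplexity.perPoly (Fin n) ℂ = ∑ t, ℓ t * h t) :
    n ≤ w :=
  stub_sliceRankOfBound n (perVanishingSubspace_bound n) w ℓ h hℓ hper


/-! ## §6 The homothety–strength bound (reshape 6, continuation lead c2): from the crux to
restricted strength, rung by rung

The crux forces, at every size `m ≥ dc(per_n)`, a representation with exact lifts of all
homotheties (`homothetyLifts_of_orbitDimensionBound`, landed).  This section turns exact homothety
lifts into a DEGREE GRADING of the pencil (`stub_homothetyGraded`: one lift of `x ↦ 2x`, eigen-gauge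
`stub_eigenGauge` p162439, degree map `stub_degMap` p162587), the grading into a GRADED NORMAL FORM
(constant part `diag(0, 1, …, 1)`, by graded Gaussian elimination `stub_gradedElimination` and the
combinatorics of partial permutation matrices `stub_partialPermDiag`, assembled in wave 3), and the
graded normal form into LAYER DECOMPOSITIONS (`stub_layerDecomposition`:
`per_n = (-1)^{n-1} uᵀ N^{n-2} v` for the bordered unipotent pencil, cut after `λ` steps) — the
pencil form of Gesmundo–Ghosal–Ikenmeyer–Lysikov's Thm. 12: the internal indices split into levels
`1, …, n-1` and level `λ` has at least `str_λ(per_n)` members.  With §5 (`sr(per_n) = n`) this gives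
`crux ⇒ dc(per_n) ≥ 2n - 1 + Σ_{λ=2}^{n-2} (width of level λ)`, and at `n = 4`:
`crux ∧ dc(per_4) ≤ 14 ⇒ str_2(per_4) ≤ 5` — the crux at `n = 4` is pinned to the single number
`str_2(per_4)` (two-row Laplace gives `≤ 6`; for `det_4` the analogue is `3`, the Pfaffian identity). -/

/-- **Registered stub `stub_homothetyGraded`** (reshape 6).  Exact `GL_m × GL_m` lifts of all
homotheties `x ↦ c x` on an affine determinantal representation `B` of `per_n` yield a representation
`B'` of the same size that is GRADED BY DEGREE: integer potentials `a` (rows), `b` (columns) with a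
constant at `(i,j)` only if `a i + b j = 0` and a variable only if `a i + b j = 1`.  Proof: one lift
`(g, h)` of `c = 2` gives `g B₀ = B₀ h`, `g B_v = 2 B_v h` (`constPart_linSubstEntries`,
`coeffMat_linSubstEntries`); `stub_eigenGauge` gauges to supports `lam i = mu j` (constants),
`lam i = 2 mu j` (variables); `stub_degMap` (`s = 1`, `p = 2`) gives `Deg (2 z) = Deg z + 1`, and
`a i = Deg (lam i)`, `b j = -Deg (mu j)`. [folklore] -/
theorem stub_homothetyGraded :
    ∀ (n m : ℕ) (B : Matrix (Fin m) (Fin m) (MvPolynomial (Fin n × Fin n) ℂ)),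
      Literature.Computability.AlgebraicComplexity.IsAffineDetRepr
        (Literature.Computability.AlgebraicComplexity.perPoly (Fin n) ℂ) B →
      (∀ (c : ℂˣ) (γ : GL (Fin n × Fin n) ℂ),
        (γ : Matrix (Fin n × Fin n) (Fin n × Fin n) ℂ) = Matrix.diagonal (fun _ => (c : ℂ)) →
        ∃ g h : GL (Fin m) ℂ,
          Literature.Computability.AlgebraicComplexity.Matrix.linSubstEntries γ B =
            (g : Matrix (Fin m) (Fin m) ℂ).map MvPolynomial.C * B *
              ((h⁻¹ : GL (Fin m) ℂ) : Matrix (Fin m) (Fin m) ℂ).map MvPolynomial.C) →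
      ∃ (B' : Matrix (Fin m) (Fin m) (MvPolynomial (Fin n × Fin n) ℂ)) (a b : Fin m → ℤ),
        Literature.Computability.AlgebraicComplexity.IsAffineDetRepr
          (Literature.Computability.AlgebraicComplexity.perPoly (Fin n) ℂ) B' ∧
        (∀ i j, Literature.Computability.AlgebraicComplexity.constPart B' i j ≠ 0 → a i + b j = 0) ∧
        (∀ i j (v : Fin n × Fin n),
          Literature.Computability.AlgebraicComplexity.LRPencil.coeffMat B' v i j ≠ 0 →
          a i + b j = 1) :=
  -- LANDED p173866 (wave 2)
  Summit.ValiantsHypothesis.ValiantsHypothesis.Theorems.FreeSubtorusOrbitDimensionBound.stub_homothetyGraded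

/-- **Registered stub `stub_gradedElimination`** (reshape 6; graded Gaussian elimination).  A
matrix `X` graded of degree `0` for integer weights `wr` (rows) and `wc` (columns) — `X i j ≠ 0`
only if `wr i = wc j` — can be brought by GRADED invertible row and column operations (`P i i' ≠ 0`
only if `wr i = wr i'`, `Q j j' ≠ 0` only if `wc j = wc j'`) to a `0/1` matrix with at most one `1`
in each row and each column: pick a non-zero entry, scale its row, clear its column by row
transvections (graded: a row meeting column `j` has weight `wc j`) and its row by column
transvections, and induct. [folklore] -/
theorem stub_gradedElimination :
    ∀ {m : ℕ} (wr wc : Fin m → ℤ) (X : Matrix (Fin m) (Fin m) ℂ),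
      (∀ i j, X i j ≠ 0 → wr i = wc j) →
      ∃ (P Q : Matrix (Fin m) (Fin m) ℂ), IsUnit P ∧ IsUnit Q ∧
        (∀ i i', P i i' ≠ 0 → wr i = wr i') ∧ (∀ j j', Q j j' ≠ 0 → wc j = wc j') ∧
        (∀ i j, (P * X * Q) i j = 0 ∨ (P * X * Q) i j = 1) ∧
        (∀ i j j', (P * X * Q) i j ≠ 0 → (P * X * Q) i j' ≠ 0 → j = j') ∧
        (∀ i i' j, (P * X * Q) i j ≠ 0 → (P * X * Q) i' j ≠ 0 → i = i') :=
  -- LANDED p173965 (wave 2)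
  @Summit.ValiantsHypothesis.ValiantsHypothesis.Theorems.FreeSubtorusOrbitDimensionBound.stub_gradedElimination

/-- **Registered stub `stub_partialPermDiag`** (reshape 6; combinatorics of partial permutation
matrices).  A `0/1` matrix with at most one `1` in each row and column and of rank `m - 1` has
exactly one empty row and one empty column, and row/column permutations bring it to
`diag(1, …, 1)` with a single diagonal `0` at a chosen position `i₀`. [folklore] -/
theorem stub_partialPermDiag :
    ∀ {m : ℕ} (Y : Matrix (Fin m) (Fin m) ℂ),
      (∀ i j, Y i j = 0 ∨ Y i j = 1) →
      (∀ i j j', Y i j ≠ 0 → Y i j' ≠ 0 → j = j') →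
      (∀ i i' j, Y i j ≠ 0 → Y i' j ≠ 0 → i = i') →
      Y.rank + 1 = m →
      ∃ (ρ κ : Equiv.Perm (Fin m)) (i₀ : Fin m),
        ∀ i j, Y (ρ i) (κ j) = if i = j ∧ i ≠ i₀ then 1 else 0 :=
  -- LANDED p173840 (wave 2)
  @Summit.ValiantsHypothesis.ValiantsHypothesis.Theorems.FreeSubtorusOrbitDimensionBound.stub_partialPermDiag

/-- **Registered stub `stub_layerDecomposition`** (reshape 6; the layer cut).  For an affine
representation `B` of `per_n` (`n ≥ 2`) in GRADED NORMAL FORM — potentials `a, b` with constants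
only where `a i + b j = 0`, variables only where `a i + b j = 1`, and constant part
`diag(1, …, 1)` with a `0` at `i₀` — and every `1 ≤ λ ≤ n - 1`, `per_n = Σ_j g_j h_j` with `g_j`
homogeneous of degree `λ` and `g_j ≠ 0` only for `j` at level `λ` (`a j = a i₀ - λ`).  Proof:
write `B = [[0, uᵀ], [v, 1 + N]]` around `i₀` (`B_{i₀ i₀} = 0` by degrees); `N i j ≠ 0 ⇒ a i = a j + 1`
so `1 + N` is unipotent, `det B = -uᵀ (1 + N)⁻¹ v = -Σ_k (-1)^k uᵀ N^k v`
(`Matrix.det_fromBlocks₂₂` / `det_fromBlocks_one₂₂`), whose degree-`n` component is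
`per_n = (-1)^{n-1} uᵀ N^{n-2} v`; cut the product after `λ` factors:
`g_j = (-1)^{n-1} (uᵀ N^{λ-1})_j`, `h_j = (N^{n-1-λ} v)_j`. [cite: GesmundoGhosalIkenmeyerLysikov2022, Thm. 12] -/
theorem stub_layerDecomposition :
    ∀ (n m : ℕ), 2 ≤ n →
      ∀ (B : Matrix (Fin m) (Fin m) (MvPolynomial (Fin n × Fin n) ℂ)) (a b : Fin m → ℤ) (i₀ : Fin m),
      Literature.Computability.AlgebraicComplexity.IsAffineDetRepr
        (Literature.Computability.AlgebraicComplexity.perPoly (Fin n) ℂ) B →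
      (∀ i j, Literature.Computability.AlgebraicComplexity.constPart B i j ≠ 0 → a i + b j = 0) →
      (∀ i j (v : Fin n × Fin n),
        Literature.Computability.AlgebraicComplexity.LRPencil.coeffMat B v i j ≠ 0 → a i + b j = 1) →
      (∀ i j, Literature.Computability.AlgebraicComplexity.constPart B i j =
        if i = j ∧ i ≠ i₀ then 1 else 0) →
      ∀ l : ℕ, 1 ≤ l → l + 1 ≤ n →
        ∃ g h : Fin m → MvPolynomial (Fin n × Fin n) ℂ,
          (∀ j, (g j).IsHomogeneous l) ∧ (∀ j, g j ≠ 0 → a j + (l : ℤ) = a i₀) ∧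
          Literature.Computability.AlgebraicComplexity.perPoly (Fin n) ℂ = ∑ j, g j * h j :=
  -- LANDED p174105 (wave 2)
  Summit.ValiantsHypothesis.ValiantsHypothesis.Theorems.FreeSubtorusOrbitDimensionBound.stub_layerDecomposition


/-! ### Assembly of §6 (lead): graded normal form, the homothety–strength bound, and `n = 4` -/

/-- **Graded normal form** (lead, from `stub_gradedElimination` + `stub_partialPermDiag` +
von zur Gathen regularity).  A degree-graded affine representation of `per_n` (`n ≥ 3`) is
gauge-equivalent (graded constant gauge, row/column permutations, one row rescaling) to a
degree-graded representation whose constant part is `diag(1, …, 1)` with a single `0`. [folklore] -/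
theorem gradedNormalForm (n m : ℕ) (hn : 3 ≤ n)
    (B : Matrix (Fin m) (Fin m) (MvPolynomial (Fin n × Fin n) ℂ)) (a b : Fin m → ℤ)
    (hB : Literature.Computability.AlgebraicComplexity.IsAffineDetRepr
      (Literature.Computability.AlgebraicComplexity.perPoly (Fin n) ℂ) B)
    (h0 : ∀ i j, Literature.Computability.AlgebraicComplexity.constPart B i j ≠ 0 → a i + b j = 0)
    (h1 : ∀ i j (v : Fin n × Fin n),
      Literature.Computability.AlgebraicComplexity.LRPencil.coeffMat B v i j ≠ 0 → a i + b j = 1) :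
    ∃ (B' : Matrix (Fin m) (Fin m) (MvPolynomial (Fin n × Fin n) ℂ)) (a' b' : Fin m → ℤ) (i₀ : Fin m),
      Literature.Computability.AlgebraicComplexity.IsAffineDetRepr
        (Literature.Computability.AlgebraicComplexity.perPoly (Fin n) ℂ) B' ∧
      (∀ i j, Literature.Computability.AlgebraicComplexity.constPart B' i j ≠ 0 → a' i + b' j = 0) ∧
      (∀ i j (v : Fin n × Fin n),
        Literature.Computability.AlgebraicComplexity.LRPencil.coeffMat B' v i j ≠ 0 → a' i + b' j = 1) ∧
      (∀ i j, Literature.Computability.AlgebraicComplexity.constPart B' i j =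
        if i = j ∧ i ≠ i₀ then 1 else 0) := by
  classical
  set X₀ := Literature.Computability.AlgebraicComplexity.constPart B with hX₀
  -- graded elimination of the constant part (weights `a` on rows, `-b` on columns)
  obtain ⟨P, Q, hP, hQ, hPg, hQg, h01, hrow, hcol⟩ :=
    stub_gradedElimination a (fun j => -b j) X₀ (fun i j hij => by have := h0 i j hij; omega)
  -- regularity: `rank X₀ = m - 1`, preserved by the invertible `P, Q`
  have hreg := (isRegularDetRepr_perPoly vonzurGathen1987_perm_detRepr_rank_holds hn hB).2
  have hPdet : IsUnit P.det := (Matrix.isUnit_iff_isUnit_det P).1 hP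
  have hQdet : IsUnit Q.det := (Matrix.isUnit_iff_isUnit_det Q).1 hQ
  have hrank : (P * X₀ * Q).rank = m - 1 := by
    rw [Matrix.rank_mul_eq_left_of_isUnit_det Q _ hQdet, Matrix.rank_mul_eq_right_of_isUnit_det P _ hPdet]
    exact hreg
  -- `m ≥ 1` (a `0 × 0` determinant is `1 ≠ per_n`)
  have hm : 1 ≤ m := by
    rcases Nat.eq_zero_or_pos m with rfl | h
    · exfalso
      have hdet := hB.2
      rw [Matrix.det_isEmpty] at hdet
      have h3 := totalDegree_perPoly_holds (n := Fin n) (k := ℂ)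
      rw [← hdet, totalDegree_one, Fintype.card_fin] at h3
      omega
    · exact h
  obtain ⟨ρ, κ, i₀, hY⟩ := stub_partialPermDiag (P * X₀ * Q) h01 hrow hcol (by omega)
  -- the gauged, permuted representation and the correcting constant
  set B₁ : Matrix (Fin m) (Fin m) (MvPolynomial (Fin n × Fin n) ℂ) := P.map C * B * Q.map C with hB₁
  set B₂ : Matrix (Fin m) (Fin m) (MvPolynomial (Fin n × Fin n) ℂ) := B₁.submatrix ρ κ with hB₂
  set c : ℂ := (Equiv.Perm.sign ρ : ℂ) * (Equiv.Perm.sign κ : ℂ) * (P.det * Q.det) with hc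
  have hc0 : c ≠ 0 := by
    have h1' : ((Equiv.Perm.sign ρ : ℤ) : ℂ) ≠ 0 := by
      rcases Int.units_eq_one_or (Equiv.Perm.sign ρ) with h | h <;> simp [h]
    have h2' : ((Equiv.Perm.sign κ : ℤ) : ℂ) ≠ 0 := by
      rcases Int.units_eq_one_or (Equiv.Perm.sign κ) with h | h <;> simp [h]
    exact mul_ne_zero (mul_ne_zero h1' h2') (mul_ne_zero hPdet.ne_zero hQdet.ne_zero)
  have hdetB₂ : B₂.det = C c * Literature.Computability.AlgebraicComplexity.perPoly (Fin n) ℂ := by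
    have e1 : B₂ = (B₁.submatrix id κ).submatrix ρ id := by
      ext i j; simp [hB₂, Matrix.submatrix_apply]
    rw [e1, Matrix.det_permute, Matrix.det_permute', hB₁, det_map_C_mul_mul_map_C, hB.2, hc]
    simp only [map_mul]
    have hs : ∀ τ : Equiv.Perm (Fin m), ((Equiv.Perm.sign τ : ℤ) : MvPolynomial (Fin n × Fin n) ℂ) =
        C ((Equiv.Perm.sign τ : ℤ) : ℂ) := fun τ => by simp
    rw [hs ρ, hs κ]; ring
  set d : Fin m → ℂ := fun i => if i = i₀ then c⁻¹ else 1 with hd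
  set B' : Matrix (Fin m) (Fin m) (MvPolynomial (Fin n × Fin n) ℂ) :=
    (Matrix.diagonal d).map C * B₂ with hB'
  have hB'ap : ∀ i j, B' i j = C (d i) * B₂ i j := by
    intro i j
    simp only [hB', Matrix.mul_apply, Matrix.map_apply, Matrix.diagonal_apply]
    rw [Finset.sum_eq_single i]
    · simp
    · intro k _ hk; simp [Ne.symm hk]
    · simp
  refine ⟨B', fun i => a (ρ i), fun j => b (κ j), i₀, ⟨?_, ?_⟩, ?_, ?_, ?_⟩
  · -- affine entries
    intro i j
    rw [hB'ap]
    refine (totalDegree_mul _ _).trans ?_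
    rw [totalDegree_C, zero_add, hB₂, Matrix.submatrix_apply, hB₁]
    exact totalDegree_map_C_mul_mul_map_C_le P Q hB.1 _ _
  · -- determinant
    have e2 : B' = B₂.updateRow i₀ ((C c⁻¹ : MvPolynomial (Fin n × Fin n) ℂ) • B₂ i₀) := by
      ext i j
      rw [hB'ap, Matrix.updateRow_apply]
      by_cases hi : i = i₀
      · subst hi; simp [hd]
      · simp [hd, hi]
    rw [e2, Matrix.det_updateRow_smul, Matrix.updateRow_eq_self, hdetB₂, ← mul_assoc, ← map_mul,
      inv_mul_cancel₀ hc0, map_one, one_mul]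
  · -- constants are graded
    intro i j hij
    rw [Literature.Computability.AlgebraicComplexity.constPart_apply, hB'ap, map_mul,
      constantCoeff_C] at hij
    have hij' : constantCoeff (B₂ i j) ≠ 0 := right_ne_zero_of_mul hij
    rw [hB₂, Matrix.submatrix_apply, ← Literature.Computability.AlgebraicComplexity.constPart_apply,
      hB₁, constPart_mul, constPart_map_C, constPart_mul, constPart_map_C, ← hX₀] at hij'
    -- `(P X₀ Q) (ρ i) (κ j) ≠ 0`: unfold the two products
    rw [Matrix.mul_apply] at hij'
    obtain ⟨j', _, hj'⟩ := Finset.exists_ne_zero_of_sum_ne_zero hij'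
    have hQ' : Q j' (κ j) ≠ 0 := right_ne_zero_of_mul hj'
    have hPX : (P * X₀) (ρ i) j' ≠ 0 := left_ne_zero_of_mul hj'
    rw [Matrix.mul_apply] at hPX
    obtain ⟨i', _, hi'⟩ := Finset.exists_ne_zero_of_sum_ne_zero hPX
    have h := h0 i' j' (right_ne_zero_of_mul hi')
    have hp := hPg _ _ (left_ne_zero_of_mul hi')
    have hq : -b j' = -b (κ j) := hQg _ _ hQ'
    show a (ρ i) + b (κ j) = 0
    omega
  · -- variables are graded
    intro i j v hij
    rw [Literature.Computability.AlgebraicComplexity.LRPencil.coeffMat_apply, hB'ap, coeff_C_mul] at hij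
    have hij' : coeff (Finsupp.single v 1) (B₂ i j) ≠ 0 := right_ne_zero_of_mul hij
    rw [hB₂, Matrix.submatrix_apply, ← Literature.Computability.AlgebraicComplexity.LRPencil.coeffMat_apply,
      hB₁, coeffMat_C_mul_mul_C, Matrix.mul_apply] at hij'
    obtain ⟨j', _, hj'⟩ := Finset.exists_ne_zero_of_sum_ne_zero hij'
    have hQ' : Q j' (κ j) ≠ 0 := right_ne_zero_of_mul hj'
    have hPX : (P * Literature.Computability.AlgebraicComplexity.LRPencil.coeffMat B v) (ρ i) j' ≠ 0 :=
      left_ne_zero_of_mul hj'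
    rw [Matrix.mul_apply] at hPX
    obtain ⟨i', _, hi'⟩ := Finset.exists_ne_zero_of_sum_ne_zero hPX
    have h := h1 i' j' v (right_ne_zero_of_mul hi')
    have hp := hPg _ _ (left_ne_zero_of_mul hi')
    have hq : -b j' = -b (κ j) := hQg _ _ hQ'
    show a (ρ i) + b (κ j) = 1
    omega
  · -- the constant part is `diag` with a hole at `i₀`
    intro i j
    rw [Literature.Computability.AlgebraicComplexity.constPart_apply, hB'ap, map_mul, constantCoeff_C,
      hB₂, Matrix.submatrix_apply, ← Literature.Computability.AlgebraicComplexity.constPart_apply, hB₁,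
      constPart_mul, constPart_map_C, constPart_mul, constPart_map_C, ← hX₀, hY i j]
    by_cases hi : i = i₀
    · subst hi; simp [hd]
    · simp [hd, hi]


/-- **The homothety–strength bound** (lead, from the four stubs of reshape 6): exact lifts of all
homotheties on an affine representation of `per_n` (`n ≥ 3`) of size `m` give integer levels
`a : Fin m → ℤ` and a distinguished index `i₀` such that for every `1 ≤ λ ≤ n - 1`,
`per_n = Σ_j g_j h_j` with `g_j` homogeneous of degree `λ` and supported on the level
`a j = a i₀ - λ`.  Pencil form of GGIL22 Thm. 12. [cite: GesmundoGhosalIkenmeyerLysikov2022, Thm. 12] -/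
theorem homothetyStrengthBound (n m : ℕ) (hn : 3 ≤ n)
    (B : Matrix (Fin m) (Fin m) (MvPolynomial (Fin n × Fin n) ℂ))
    (hB : Literature.Computability.AlgebraicComplexity.IsAffineDetRepr
      (Literature.Computability.AlgebraicComplexity.perPoly (Fin n) ℂ) B)
    (hlift : ∀ (c : ℂˣ) (γ : GL (Fin n × Fin n) ℂ),
        (γ : Matrix (Fin n × Fin n) (Fin n × Fin n) ℂ) = Matrix.diagonal (fun _ => (c : ℂ)) →
        ∃ g h : GL (Fin m) ℂ,
          Literature.Computability.AlgebraicComplexity.Matrix.linSubstEntries γ B =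
            (g : Matrix (Fin m) (Fin m) ℂ).map MvPolynomial.C * B *
              ((h⁻¹ : GL (Fin m) ℂ) : Matrix (Fin m) (Fin m) ℂ).map MvPolynomial.C) :
    ∃ (a : Fin m → ℤ) (i₀ : Fin m), ∀ l : ℕ, 1 ≤ l → l + 1 ≤ n →
      ∃ g h : Fin m → MvPolynomial (Fin n × Fin n) ℂ,
        (∀ j, (g j).IsHomogeneous l) ∧ (∀ j, g j ≠ 0 → a j + (l : ℤ) = a i₀) ∧
        Literature.Computability.AlgebraicComplexity.perPoly (Fin n) ℂ = ∑ j, g j * h j := by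
  obtain ⟨B₁, a₁, b₁, hB₁, h0, h1⟩ := stub_homothetyGraded n m B hB hlift
  obtain ⟨B₂, a₂, b₂, i₀, hB₂, h0', h1', hdiag⟩ := gradedNormalForm n m hn B₁ a₁ b₁ hB₁ h0 h1
  exact ⟨a₂, i₀, fun l hl hln => stub_layerDecomposition n m (by omega) B₂ a₂ b₂ i₀ hB₂ h0' h1' hdiag l hl hln⟩

/-- Reindexing a decomposition supported on a finset: if `per = Σ_j g_j h_j` and `g_j = 0` off
`S`, then `per = Σ_{t : Fin |S|} g (e t) h (e t)` for the enumeration `e` of `S`. [folklore] -/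
theorem sum_restrict_equivFin {n m : ℕ} (g h : Fin m → MvPolynomial (Fin n × Fin n) ℂ)
    (S : Finset (Fin m)) (hS : ∀ j, j ∉ S → g j = 0)
    (hsum : Literature.Computability.AlgebraicComplexity.perPoly (Fin n) ℂ = ∑ j, g j * h j) :
    Literature.Computability.AlgebraicComplexity.perPoly (Fin n) ℂ =
      ∑ t : Fin S.card, g ((S.equivFin.symm t : S) : Fin m) * h ((S.equivFin.symm t : S) : Fin m) := by
  rw [hsum, ← Finset.sum_subset (Finset.subset_univ S)
    (fun j _ hj => by rw [hS j hj, zero_mul])]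
  rw [← Finset.sum_coe_sort S]
  exact (Fintype.sum_equiv S.equivFin.symm _ _ (fun t => rfl)).symm

/-- Degree bookkeeping: if `per_n = Σ g_j h_j` with `g_j` homogeneous of degree `n - 1`, the
degree-`1` components of the `h_j` already suffice. [folklore] -/
theorem perPoly_eq_sum_mul_homogeneousComponent_one {n m : ℕ} (hn : 1 ≤ n)
    (g h : Fin m → MvPolynomial (Fin n × Fin n) ℂ) (hg : ∀ j, (g j).IsHomogeneous (n - 1))
    (hsum : Literature.Computability.AlgebraicComplexity.perPoly (Fin n) ℂ = ∑ j, g j * h j) :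
    Literature.Computability.AlgebraicComplexity.perPoly (Fin n) ℂ =
      ∑ j, MvPolynomial.homogeneousComponent 1 (h j) * g j := by
  classical
  have hper : (Literature.Computability.AlgebraicComplexity.perPoly (Fin n) ℂ).IsHomogeneous n := by
    simpa using (Literature.Computability.AlgebraicComplexity.perPoly_isHomogeneous (n := Fin n) (k := ℂ))
  have key : ∀ j, MvPolynomial.homogeneousComponent n (g j * h j) =
      MvPolynomial.homogeneousComponent 1 (h j) * g j := by
    intro j
    conv_lhs => rw [← MvPolynomial.sum_homogeneousComponent (h j), Finset.mul_sum, map_sum]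
    have hterm : ∀ i, MvPolynomial.homogeneousComponent n (g j * MvPolynomial.homogeneousComponent i (h j)) =
        if n = n - 1 + i then g j * MvPolynomial.homogeneousComponent i (h j) else 0 := fun i =>
      MvPolynomial.homogeneousComponent_of_mem
        ((hg j).mul (MvPolynomial.homogeneousComponent_isHomogeneous i (h j)))
    simp only [hterm]
    rw [Finset.sum_ite, Finset.sum_const_zero, add_zero]
    by_cases hmem : 1 ∈ Finset.range ((h j).totalDegree + 1)
    · have : (Finset.range ((h j).totalDegree + 1)).filter (fun i => n = n - 1 + i) = {1} := by
        ext i; simp only [Finset.mem_filter, Finset.mem_singleton]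
        constructor
        · rintro ⟨-, hi⟩; omega
        · rintro rfl; exact ⟨hmem, by omega⟩
      rw [this, Finset.sum_singleton, mul_comm]
    · have : (Finset.range ((h j).totalDegree + 1)).filter (fun i => n = n - 1 + i) = ∅ := by
        ext i; simp only [Finset.mem_filter, Finset.notMem_empty, iff_false, not_and]
        intro hi h'; have : i = 1 := by omega
        subst this; exact hmem hi
      rw [this, Finset.sum_empty]
      have h0 : MvPolynomial.homogeneousComponent 1 (h j) = 0 := by
        apply MvPolynomial.homogeneousComponent_eq_zero
        simp only [Finset.mem_range, not_lt] at hmem; omega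
      rw [h0, zero_mul]
  calc Literature.Computability.AlgebraicComplexity.perPoly (Fin n) ℂ
      = MvPolynomial.homogeneousComponent n (Literature.Computability.AlgebraicComplexity.perPoly (Fin n) ℂ) :=
        (MvPolynomial.homogeneousComponent_eq_self hper).symm
    _ = ∑ j, MvPolynomial.homogeneousComponent n (g j * h j) := by rw [hsum, map_sum]
    _ = ∑ j, MvPolynomial.homogeneousComponent 1 (h j) * g j := Finset.sum_congr rfl fun j _ => key j

/-- **The crux at `n = 4`, pinned to one number.**  `OrbitDimensionBound` forces every affine
determinantal representation of `per_4` of size `m` to come with a 2-restricted decomposition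
`per_4 = Σ_{t<w} g_t h_t` (`g_t` quadrics) with `w + 9 ≤ m`: homothety lifts (landed
`homothetyLifts_of_orbitDimensionBound`), the homothety–strength bound, `sr(per_4) = 4` at both
ends (§5) and the disjointness of the three levels.  Hence `crux ∧ dc(per_4) ≤ 14 ⇒ str_2(per_4) ≤ 5`.
[cite: GesmundoGhosalIkenmeyerLysikov2022, Thm. 12] -/
theorem orbitDimensionBound_strength_four
    (hcrux : Summit.ValiantsHypothesis.ValiantsHypothesis.Theses.FreeSubtorus.OrbitDimensionBound) :
    ∀ (m : ℕ) (A : Matrix (Fin m) (Fin m) (MvPolynomial (Fin 4 × Fin 4) ℂ)),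
      Literature.Computability.AlgebraicComplexity.IsAffineDetRepr
        (Literature.Computability.AlgebraicComplexity.perPoly (Fin 4) ℂ) A →
      ∃ (w : ℕ) (g h : Fin w → MvPolynomial (Fin 4 × Fin 4) ℂ),
        w + 9 ≤ m ∧ (∀ t, (g t).IsHomogeneous 2) ∧
        Literature.Computability.AlgebraicComplexity.perPoly (Fin 4) ℂ = ∑ t, g t * h t := by
  classical
  intro m A hA
  obtain ⟨B, hB, hlift⟩ :=
    Summit.ValiantsHypothesis.ValiantsHypothesis.Theorems.FreeSubtorusOrbitDimensionBound.homothetyLifts_of_orbitDimensionBound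
      hcrux 4 (by norm_num) m A hA
  obtain ⟨a, i₀, H⟩ := homothetyStrengthBound 4 m (by norm_num) B hB hlift
  obtain ⟨g₁, h₁, hg₁, hl₁, hs₁⟩ := H 1 le_rfl (by norm_num)
  obtain ⟨g₂, h₂, hg₂, hl₂, hs₂⟩ := H 2 (by norm_num) (by norm_num)
  obtain ⟨g₃, h₃, hg₃, hl₃, hs₃⟩ := H 3 (by norm_num) (by norm_num)
  -- the three levels
  set S : ℕ → Finset (Fin 4 |> fun _ => Fin m) := fun l => Finset.univ.filter (fun j : Fin m => a j + (l : ℤ) = a i₀) with hSdef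
  have hS : ∀ (l : ℕ) (g : Fin m → MvPolynomial (Fin 4 × Fin 4) ℂ),
      (∀ j, g j ≠ 0 → a j + (l : ℤ) = a i₀) → ∀ j, j ∉ S l → g j = 0 := by
    intro l g hl j hj
    by_contra hne
    exact hj (by simp [hSdef, hl j hne])
  -- level 1 has ≥ 4 members (slice rank at the source)
  have h4₁ : 4 ≤ (S 1).card :=
    sliceRank_perPoly 4 _ _ _ (fun t => hg₁ _) (sum_restrict_equivFin g₁ h₁ (S 1) (hS 1 g₁ hl₁) hs₁)
  -- level 3 has ≥ 4 members (slice rank at the sink: degree-1 parts of the cofactors)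
  have h4₃ : 4 ≤ (S 3).card := by
    have hs₃' := perPoly_eq_sum_mul_homogeneousComponent_one (n := 4) (by norm_num) g₃ h₃ hg₃ hs₃
    have hs₃'' := sum_restrict_equivFin (fun j => MvPolynomial.homogeneousComponent 1 (h₃ j) * g₃ j)
      (fun _ => (1 : MvPolynomial (Fin 4 × Fin 4) ℂ)) (S 3)
      (fun j hj => by rw [hS 3 g₃ hl₃ j hj, mul_zero]) (by simpa using hs₃')
    have hs₄ : Literature.Computability.AlgebraicComplexity.perPoly (Fin 4) ℂ =
        ∑ t : Fin (S 3).card, MvPolynomial.homogeneousComponent 1 (h₃ ((S 3).equivFin.symm t : Fin m)) *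
          g₃ ((S 3).equivFin.symm t : Fin m) := by
      simpa [mul_one] using hs₃''
    exact sliceRank_perPoly 4 _
      (fun t => MvPolynomial.homogeneousComponent 1 (h₃ ((S 3).equivFin.symm t : Fin m)))
      (fun t => g₃ ((S 3).equivFin.symm t : Fin m))
      (fun t => MvPolynomial.homogeneousComponent_isHomogeneous 1 _) hs₄
  -- the three levels are pairwise disjoint and avoid `i₀`
  have hdisj : ∀ l l' : ℕ, l ≠ l' → Disjoint (S l) (S l') := by
    intro l l' hll'
    rw [Finset.disjoint_left]
    intro j hj hj'
    simp only [hSdef, Finset.mem_filter, Finset.mem_univ, true_and] at hj hj'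
    omega
  have hi₀ : ∀ l : ℕ, 1 ≤ l → i₀ ∉ S l := by
    intro l hl h
    simp only [hSdef, Finset.mem_filter, Finset.mem_univ, true_and] at h
    omega
  have hcard : (S 1).card + (S 2).card + (S 3).card + 1 ≤ m := by
    have hu : (S 1 ∪ S 2 ∪ S 3 ∪ {i₀}).card ≤ m := by
      simpa using Finset.card_le_univ (S 1 ∪ S 2 ∪ S 3 ∪ {i₀})
    have e : (S 1 ∪ S 2 ∪ S 3 ∪ {i₀}).card = (S 1).card + (S 2).card + (S 3).card + 1 := by
      rw [Finset.card_union_of_disjoint, Finset.card_union_of_disjoint, Finset.card_union_of_disjoint,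
        Finset.card_singleton]
      · exact hdisj 1 2 (by norm_num)
      · rw [Finset.disjoint_union_left]; exact ⟨hdisj 1 3 (by norm_num), hdisj 2 3 (by norm_num)⟩
      · rw [Finset.disjoint_singleton_right]
        simp only [Finset.mem_union, not_or]
        exact ⟨⟨hi₀ 1 le_rfl, hi₀ 2 (by norm_num)⟩, hi₀ 3 (by norm_num)⟩
    omega
  -- the middle level is the 2-restricted decomposition
  refine ⟨(S 2).card, fun t => g₂ ((S 2).equivFin.symm t : Fin m), fun t => h₂ ((S 2).equivFin.symm t : Fin m),
    by omega, fun t => hg₂ _, sum_restrict_equivFin g₂ h₂ (S 2) (hS 2 g₂ hl₂) hs₂⟩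

/-- **Corollary: `crux ∧ str_2(per_4) ≥ 6 ⇒ dc(per_4) = 15`** — the crux at `n = 4` is exactly
Grenet optimality as soon as two-row Laplace expansion is optimal among quadratic expansions of
`per_4` (for `det_4` the analogous number is `3`). [cite: Grenet2011, Thm. 1] -/
theorem orbitDimensionBound_dc_four
    (hcrux : Summit.ValiantsHypothesis.ValiantsHypothesis.Theses.FreeSubtorus.OrbitDimensionBound)
    (hstr : ∀ (w : ℕ) (g h : Fin w → MvPolynomial (Fin 4 × Fin 4) ℂ), (∀ t, (g t).IsHomogeneous 2) →
      Literature.Computability.AlgebraicComplexity.perPoly (Fin 4) ℂ = ∑ t, g t * h t → 6 ≤ w) :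
    Literature.Computability.AlgebraicComplexity.determinantalComplexity
      (Literature.Computability.AlgebraicComplexity.perPoly (Fin 4) ℂ) = 15 := by
  apply le_antisymm
  · exact determinantalComplexity_perPoly_le_holds ℂ 4 (by norm_num)
  · obtain ⟨A, hA⟩ := hasDetRepr_determinantalComplexity_holds
      (Literature.Computability.AlgebraicComplexity.perPoly (Fin 4) ℂ)
    obtain ⟨w, g, h, hw, hg, hs⟩ := orbitDimensionBound_strength_four hcrux _ A hA
    have := hstr w g h hg hs
    omega

end

end Summit.ValiantsHypothesis.ValiantsHypothesis.Cruxes.OrbitDimensionBound.Sketch
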